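import Summits.ABC.ABC.Theses.DefiniteXi
import Literature.NumberTheory.Automorphic.BrandtSetupAdmissible
import Literature.NumberTheory.Automorphic.BrandtXiSetupIndependence
import Literature.NumberTheory.EllipticCurves.TakahashiDegreeFormula
import Literature.NumberTheory.DiophantineGeometry.ConductorRadicalProofs
import Summits.ABC.ABC.Theorems.XiBound.Negative.XiBoundDomainSetup
import Literature.NumberTheory.EllipticCurves.SerreFreyValuationProductProofs
import Literature.Barriers.ABC.SzpiroEpsilonCannotBeDroppedHolds

/-!
# Disproof of `SteinbergCore` (stmt-ABC-15024, route ABC/DefiniteXi) — findings of the standing disprover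

Crux: `∀ ε > 0 ∃ C, ∀ coprime a b (ab(a+b) ≠ 0), N = N(E_(a,b)), ∀ admissible Nm ∣ N:
cps ξ(E;N/Nm,Nm) · T(E) ≤ C N^(2+ε)`, `cps n = n / (2^{v₂ n} 3^{v₃ n})`, `T(E) = ∏_{q ∣ N} v_q(Δ_min(E_(a,b)))`,
`ξ = brandtXi (N/Nm) Nm (a_n(E))`.

FINDINGS (cycle 1, refuter-cdisprove-stmt-ABC-15024-0, 2026-08-16) — details in the docstrings below:
* NO KILL.  The crux is abc-hard in both directions: it is implied by abc (deg ≤ N^(2+ε) + T = N^(o(1)) under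
  Szpiro + PW 6.8 at ℓ ≥ 5), and refuting it requires (§C) a family of Frey classes whose PRIME-TO-6 optimal modular
  degree times T(E) beats C·N^(2+ε)·c_r — abc-violating growth.  No finite census bears on it (∃ C).
* §A  the prime-to-6 projection: junk-free (`cps 0 = 0`, `1 ≤ cps n ↔ n ≠ 0`), multiplicative, `cps n ≤ n`.
* §B  DOMAIN: on the whole domain a Brandt setup of type `(N/Nm, Nm)` exists and every setup computes `brandtXi`
  (reused from `XiBound.Negative`); the guards `Squarefree Nm`, `Odd ω(Nm)` are decorative for the truth of the
  bound (dropping them adds only setup-less instances with value `0`); WLOG `0 ≤ C`; negation normal form.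
* §C  LOCKS (what ¬SteinbergCore costs): (i) Tamagawa lock — SteinbergCore forces `T(E) ≤ C_ε N^(2+ε)` wherever
  `ξ ≠ 0`, i.e. the exponent-2 sharpening ON FREY CURVES of Pasten's product theorem (tree fact pasten, 8/3 → 2);
  (ii) Takahashi lock — with `takahashi2001_thm_2_3` (δ·i = ξ·j, i j = c_r), `cps δ_opt ≤ cps ξ · c_r`, so
  SteinbergCore ⟹ `cps(δ_opt) · T(E) ≤ C_ε N^(2+ε) · c_r(W_opt)` ("Frey degree conjecture away from 6, up to one
  Tamagawa exponent"), and conversely the refutation schema `not_steinbergCore_of_large_primeToSix_optimal_degrees`.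
* §D  LOAD-BEARING: `0 < ε` is load-bearing (`steinbergCore_false_without_eps_pos`, modulo the existence of optimal
  data on Frey classes of unbounded squarefree conductor — true, BCDT, formal debt); the side conditions on `Nm` and
  `IsCoprime`/`ab(a+b) ≠ 0` are NOT refutation handles (dropping them yields trivially-true or still-abc-implied
  statements, §B/§D docstrings).
* §E  LINE `Sketch` (card steinberg-linvariant-slice): `stub_ledgerCore` is crux-sized (lead's converse);
  `stub_sliceExcess` as stated charges the level-lowering depth `Σ_{q ∣ N, q ∤ Nm} v_ℓ(c_q)` of the NON-quarantined
  primes to the `N^ε` slack (pointwise the ledger is exceeded by construction; repair: multiply the cap by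
  `∏_{q∤Nm} ℓ^{v_ℓ(c_q)}`, the general glue takes any cap), and its on-level regime `ℓ ∣ Nm` lies OUTSIDE the tree's
  PW 6.8 fact (`p ∤ N`); census kit j017472 (ALL Frey curves with c ≤ 2500, N ≤ 8·10⁴: 3833 curves, 10029 on-level
  instances) finds the clean on-level depth NOT rigid: `P(v_ℓ deg ≥ 1) ≈ 1/ℓ`, each further level `≈ 1/(2ℓ)`, 50
  excess events over the repaired ledger incl. depth-3 at N = 24720 (ℓ=5) and 77777 (ℓ=7); Wieferich depth W ≥ 1
  doubles the rate (the L-invariant term is real) but does not bound it.  Kill criterion (b): log(cps(deg)·T)/log N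
  ≤ 1.44 for N ≥ 10⁴ (no strike).  §E4–E5.
-/

-- `Summit.<Summit>.<Problem>` is the mandated summit-side namespace; for the single-conjunct summit `ABC` the
-- duplicate `ABC.ABC` is deliberate.
set_option linter.dupNamespace false

noncomputable section

open scoped BigOperators
open Literature.NumberTheory.Automorphic Literature.NumberTheory.EllipticCurves
open Literature.NumberTheory.EllipticCurves.ModularForms
open Summit.ABC.ABC.Theses.DefiniteXi
open Summit.ABC.ABC.Theorems.XiBound.Negative (nonempty_xiSetup_freyCurve brandtXi_freyCurve_eq_xi)
open Literature.Barriers.ABC UniqueFactorizationMonoid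

namespace Summit.ABC.ABC.Cruxes.SteinbergCore.Disproof

/-! ## §A  The prime-to-6 projection `cps n = n / (2^{v₂ n} · 3^{v₃ n})` -/

/-- `2^{v₂ n} · 3^{v₃ n} ∣ n`. [folklore] -/
theorem sixPart_dvd (n : ℕ) : ordProj[2] n * ordProj[3] n ∣ n := by
  rcases Nat.eq_zero_or_pos n with rfl | _
  · exact dvd_zero _
  · exact Nat.Coprime.mul_dvd_of_dvd_of_dvd
      (Nat.Coprime.pow _ _ (by norm_num : Nat.Coprime 2 3)) (Nat.ordProj_dvd n 2) (Nat.ordProj_dvd n 3)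

/-- `0 < 2^{v₂ n} · 3^{v₃ n}`. [folklore] -/
theorem sixPart_pos (n : ℕ) : 0 < ordProj[2] n * ordProj[3] n := by positivity

/-- **No junk at `ξ ≠ 0`, junk `0` at `ξ = 0`**: `1 ≤ cps n ↔ n ≠ 0` (and `cps 0 = 0 / 1 = 0`). So the LHS of the
crux vanishes exactly on the instances where `brandtXi = 0` (no setup — never on the domain, §B — or an eigen-lattice
that is not a line). [folklore] -/
theorem one_le_primeToSix_iff (n : ℕ) : 1 ≤ n / (ordProj[2] n * ordProj[3] n) ↔ n ≠ 0 := by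
  rw [Nat.succ_le_iff, Nat.div_pos_iff]
  constructor
  · rintro ⟨-, h⟩ rfl
    exact absurd h (not_le.mpr (sixPart_pos 0))
  · intro h
    exact ⟨sixPart_pos n, Nat.le_of_dvd (Nat.pos_of_ne_zero h) (sixPart_dvd n)⟩

/-- `cps 0 = 0`. [folklore] -/
theorem primeToSix_zero : (0 : ℕ) / (ordProj[2] (0 : ℕ) * ordProj[3] (0 : ℕ)) = 0 := Nat.zero_div _

/-- `cps n ≤ n`. [folklore] -/
theorem primeToSix_le (n : ℕ) : n / (ordProj[2] n * ordProj[3] n) ≤ n := Nat.div_le_self _ _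

/-- `cps n = ordCompl[3] (ordCompl[2] n)` (strip the `2`-part, then the `3`-part). [folklore] -/
theorem primeToSix_eq_ordCompl (n : ℕ) :
    n / (ordProj[2] n * ordProj[3] n) = ordCompl[3] (ordCompl[2] n) := by
  have h3 : (ordCompl[2] n).factorization 3 = n.factorization 3 := by
    rw [Nat.factorization_div (Nat.ordProj_dvd n 2)]
    simp [Nat.prime_two.factorization_pow]
  change n / (ordProj[2] n * ordProj[3] n) = n / ordProj[2] n / 3 ^ (ordCompl[2] n).factorization 3
  rw [h3, Nat.div_div_eq_div_mul]

/-- **`cps` is multiplicative**: `cps (m n) = cps m · cps n`. [folklore] -/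
theorem primeToSix_mul (m n : ℕ) :
    m * n / (ordProj[2] (m * n) * ordProj[3] (m * n)) =
      m / (ordProj[2] m * ordProj[3] m) * (n / (ordProj[2] n * ordProj[3] n)) := by
  rw [primeToSix_eq_ordCompl, primeToSix_eq_ordCompl, primeToSix_eq_ordCompl, Nat.ordCompl_mul,
    Nat.ordCompl_mul]

/-- `cps m ≤ cps (m n)` for `n ≠ 0`. [folklore] -/
theorem primeToSix_le_primeToSix_mul {m n : ℕ} (hn : n ≠ 0) :
    m / (ordProj[2] m * ordProj[3] m) ≤ m * n / (ordProj[2] (m * n) * ordProj[3] (m * n)) := by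
  rw [primeToSix_mul]
  exact Nat.le_mul_of_pos_right _ ((one_le_primeToSix_iff n).mpr hn)

/-! ## §B  Domain: setups exist, guards are decorative, normal forms -/

/-- **WLOG `0 ≤ C`.** [folklore] -/
theorem steinbergCore_iff_nonneg_const :
    SteinbergCore ↔ ∀ ε : ℝ, 0 < ε → ∃ C : ℝ, 0 ≤ C ∧ ∀ a b : ℤ, IsCoprime a b → a * b * (a + b) ≠ 0 →
      ∀ (N : ℕ) [NeZero N], (freyCurve a b).conductorNorm ℤ = N → ∀ Nm : ℕ, Odd Nm → Squarefree Nm →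
      Odd Nm.primeFactors.card → Nm ∣ N →
      ((brandtXi (N / Nm) Nm (fun n => (freyCurve a b).LFunction n) /
          (ordProj[2] (brandtXi (N / Nm) Nm (fun n => (freyCurve a b).LFunction n)) *
            ordProj[3] (brandtXi (N / Nm) Nm (fun n => (freyCurve a b).LFunction n))) : ℕ) : ℝ) *
        ((∏ q ∈ N.primeFactors, ((freyCurve a b).minimalDiscriminantNorm ℤ).factorization q : ℕ) : ℝ) ≤
        C * (N : ℝ) ^ (2 + ε) := by
  constructor
  · intro h ε hε
    obtain ⟨C, hC⟩ := h ε hε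
    refine ⟨max C 0, le_max_right _ _, fun a b hab h0 N _ hN Nm h1 h2 h3 h4 => ?_⟩
    exact (hC a b hab h0 N hN Nm h1 h2 h3 h4).trans
      (mul_le_mul_of_nonneg_right (le_max_left _ _) (Real.rpow_nonneg (Nat.cast_nonneg _) _))
  · intro h ε hε
    obtain ⟨C, -, hC⟩ := h ε hε
    exact ⟨C, hC⟩

/-- **Setup form.** On the whole domain a Brandt setup of type `(N/Nm, Nm)` exists
(`XiBound.Negative.nonempty_xiSetup_freyCurve`) and every setup computes `brandtXi`
(`Brandt.XiSetup.brandtXi_eq_xi`): the crux is equivalent to the same bound with `S.xi` for EVERY setup `S`.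
Provers may fix a realisation of the Brandt module; refuters may use any. [folklore] -/
theorem steinbergCore_iff_forall_setup :
    SteinbergCore ↔ ∀ ε : ℝ, 0 < ε → ∃ C : ℝ, ∀ a b : ℤ, IsCoprime a b → a * b * (a + b) ≠ 0 →
      ∀ (N : ℕ) [NeZero N], (freyCurve a b).conductorNorm ℤ = N → ∀ Nm : ℕ, Odd Nm → Squarefree Nm →
      Odd Nm.primeFactors.card → Nm ∣ N → ∀ S : Brandt.XiSetup (N / Nm) Nm,
      ((S.xi (fun n => (freyCurve a b).LFunction n) /
          (ordProj[2] (S.xi (fun n => (freyCurve a b).LFunction n)) *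
            ordProj[3] (S.xi (fun n => (freyCurve a b).LFunction n))) : ℕ) : ℝ) *
        ((∏ q ∈ N.primeFactors, ((freyCurve a b).minimalDiscriminantNorm ℤ).factorization q : ℕ) : ℝ) ≤
        C * (N : ℝ) ^ (2 + ε) := by
  constructor
  · intro h ε hε
    obtain ⟨C, hC⟩ := h ε hε
    refine ⟨C, fun a b hab h0 N _ hN Nm h1 h2 h3 h4 S => ?_⟩
    rw [← brandtXi_freyCurve_eq_xi S a b]
    exact hC a b hab h0 N hN Nm h1 h2 h3 h4
  · intro h ε hε
    obtain ⟨C, hC⟩ := h ε hε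
    refine ⟨C, fun a b hab h0 N _ hN Nm h1 h2 h3 h4 => ?_⟩
    subst hN
    obtain ⟨S⟩ := nonempty_xiSetup_freyCurve hab h0 h1 h2 h3 h4
    rw [brandtXi_freyCurve_eq_xi S a b]
    exact hC a b hab h0 _ rfl Nm h1 h2 h3 h4 S

/-- **The guards `Squarefree Nm`, `Odd ω(Nm)` are decorative** for the truth of the bound: without them the extra
instances have no Brandt setup (`Brandt.XiSetup.squarefree`, `Brandt.XiSetup.odd_card_primeFactors`), `brandtXi`
is the junk `0`, `cps 0 = 0` and the instance reads `0 ≤ C N^(2+ε)` (true once `C ≥ 0`).  They are NOT a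
refutation handle. [folklore] -/
theorem steinbergCore_iff_dropParityAndSquarefree :
    SteinbergCore ↔ ∀ ε : ℝ, 0 < ε → ∃ C : ℝ, ∀ a b : ℤ, IsCoprime a b → a * b * (a + b) ≠ 0 →
      ∀ (N : ℕ) [NeZero N], (freyCurve a b).conductorNorm ℤ = N → ∀ Nm : ℕ, Odd Nm → Nm ∣ N →
      ((brandtXi (N / Nm) Nm (fun n => (freyCurve a b).LFunction n) /
          (ordProj[2] (brandtXi (N / Nm) Nm (fun n => (freyCurve a b).LFunction n)) *
            ordProj[3] (brandtXi (N / Nm) Nm (fun n => (freyCurve a b).LFunction n))) : ℕ) : ℝ) *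
        ((∏ q ∈ N.primeFactors, ((freyCurve a b).minimalDiscriminantNorm ℤ).factorization q : ℕ) : ℝ) ≤
        C * (N : ℝ) ^ (2 + ε) := by
  constructor
  · intro h ε hε
    obtain ⟨C, hC0, hC⟩ := steinbergCore_iff_nonneg_const.mp h ε hε
    refine ⟨C, fun a b hab h0 N _ hN Nm h1 h4 => ?_⟩
    have hnn : (0 : ℝ) ≤ C * (N : ℝ) ^ (2 + ε) := mul_nonneg hC0 (Real.rpow_nonneg (Nat.cast_nonneg _) _)
    by_cases h2 : Squarefree Nm
    · by_cases h3 : Odd Nm.primeFactors.card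
      · exact hC a b hab h0 N hN Nm h1 h2 h3 h4
      · rw [brandtXi_of_isEmpty ⟨fun S => h3 S.odd_card_primeFactors⟩]; simpa using hnn
    · rw [brandtXi_of_isEmpty ⟨fun S => h2 S.squarefree⟩]; simpa using hnn
  · intro h ε hε
    obtain ⟨C, hC⟩ := h ε hε
    exact ⟨C, fun a b hab h0 N _ hN Nm h1 _ _ h4 => hC a b hab h0 N hN Nm h1 h4⟩

/-- **Negation normal form** (the binder `∀ (N) [NeZero N], conductorNorm = N →` is inert: `N(E) > 0`,
`conductorNorm_pos_holds`): `¬ SteinbergCore` iff for some `ε > 0` and every `C` some coprime pair and admissible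
`Nm` violate the bound. [folklore] -/
theorem not_steinbergCore_iff :
    ¬ SteinbergCore ↔ ∃ ε : ℝ, 0 < ε ∧ ∀ C : ℝ, ∃ a b : ℤ, IsCoprime a b ∧ a * b * (a + b) ≠ 0 ∧ ∃ Nm : ℕ,
      Odd Nm ∧ Squarefree Nm ∧ Odd Nm.primeFactors.card ∧ Nm ∣ (freyCurve a b).conductorNorm ℤ ∧
      C * ((freyCurve a b).conductorNorm ℤ : ℝ) ^ (2 + ε) <
        ((brandtXi ((freyCurve a b).conductorNorm ℤ / Nm) Nm (fun n => (freyCurve a b).LFunction n) /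
            (ordProj[2] (brandtXi ((freyCurve a b).conductorNorm ℤ / Nm) Nm
                (fun n => (freyCurve a b).LFunction n)) *
              ordProj[3] (brandtXi ((freyCurve a b).conductorNorm ℤ / Nm) Nm
                (fun n => (freyCurve a b).LFunction n))) : ℕ) : ℝ) *
          ((∏ q ∈ ((freyCurve a b).conductorNorm ℤ).primeFactors,
              ((freyCurve a b).minimalDiscriminantNorm ℤ).factorization q : ℕ) : ℝ) := by
  constructor
  · intro h
    by_contra hcon
    push Not at hcon
    apply h
    intro ε hε
    obtain ⟨C, hC⟩ := hcon ε hε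
    refine ⟨C, fun a b hab h0 N _ hN Nm h1 h2 h3 h4 => ?_⟩
    subst hN
    exact hC a b hab h0 Nm h1 h2 h3 h4
  · rintro ⟨ε, hε, h⟩ hSC
    obtain ⟨C, hC⟩ := hSC ε hε
    obtain ⟨a, b, hab, h0, Nm, h1, h2, h3, h4, hlt⟩ := h C
    haveI := isElliptic_freyCurve h0
    haveI : NeZero ((freyCurve a b).conductorNorm ℤ) :=
      ⟨(WeierstrassCurve.conductorNorm_pos_holds (freyCurve a b)).ne'⟩
    exact (not_le.mpr hlt) (hC a b hab h0 _ rfl Nm h1 h2 h3 h4)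


/-! ## §C  Locks: what a refutation must produce -/

/-- Each factor of `T(E)` is `≥ 1`: a prime of the conductor is a prime of the minimal discriminant
(`radical_conductorNorm_eq_holds`, PROVED in the tree). [folklore] -/
theorem one_le_factorization_minimalDiscriminantNorm (W : WeierstrassCurve ℚ) [W.IsElliptic] {q : ℕ}
    (hq : q ∈ (W.conductorNorm ℤ).primeFactors) : 1 ≤ (W.minimalDiscriminantNorm ℤ).factorization q := by
  have hrad : UniqueFactorizationMonoid.radical (W.conductorNorm ℤ) =
      UniqueFactorizationMonoid.radical (W.minimalDiscriminantNorm ℤ) := W.radical_conductorNorm_eq_holds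
  have hpf : (W.conductorNorm ℤ).primeFactors = (W.minimalDiscriminantNorm ℤ).primeFactors := by
    rw [← Nat.primeFactors_radical, hrad, Nat.primeFactors_radical]
  rw [hpf] at hq
  obtain ⟨hqp, hqd, hne⟩ := Nat.mem_primeFactors.mp hq
  exact hqp.factorization_pos_of_dvd hne hqd

/-- `T(E) = ∏_{q ∣ N} v_q(Δ_min) ≥ 1` for every elliptic curve. [folklore] -/
theorem one_le_tamProd (W : WeierstrassCurve ℚ) [W.IsElliptic] :
    1 ≤ ∏ q ∈ (W.conductorNorm ℤ).primeFactors, (W.minimalDiscriminantNorm ℤ).factorization q :=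
  Nat.succ_le_of_lt (Finset.prod_pos fun _ hq => one_le_factorization_minimalDiscriminantNorm W hq)

/-- **Tamagawa lock.** `SteinbergCore` forces the full exponent product to be `≤ C_ε N^(2+ε)` at every datum
where `ξ ≠ 0` (there `cps ξ ≥ 1`).  On the domain `ξ ≠ 0` is the Jacquet–Langlands / multiplicity-one line
(certified at prime `Nm` for optimal data by `takahashi2001_thm_2_3.xi_ne_zero`), so the crux contains the
exponent-`2` sharpening, on Frey curves, of Pasten's product theorem `∏_{p∣N} v_p(Δ) ≪ N^(8/3+ε)` (tree fact
`pasten_thm_1_15`) — itself open; under Szpiro `T = N^(o(1))`. [folklore] -/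
theorem tamProd_le_of_steinbergCore (hSC : SteinbergCore) :
    ∀ ε : ℝ, 0 < ε → ∃ C : ℝ, ∀ a b : ℤ, IsCoprime a b → a * b * (a + b) ≠ 0 →
      ∀ (N : ℕ) [NeZero N], (freyCurve a b).conductorNorm ℤ = N → ∀ Nm : ℕ, Odd Nm → Squarefree Nm →
      Odd Nm.primeFactors.card → Nm ∣ N →
      brandtXi (N / Nm) Nm (fun n => (freyCurve a b).LFunction n) ≠ 0 →
      ((∏ q ∈ N.primeFactors, ((freyCurve a b).minimalDiscriminantNorm ℤ).factorization q : ℕ) : ℝ) ≤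
        C * (N : ℝ) ^ (2 + ε) := by
  intro ε hε
  obtain ⟨C, hC⟩ := hSC ε hε
  refine ⟨C, fun a b hab h0 N _ hN Nm h1 h2 h3 h4 hξ => le_trans ?_ (hC a b hab h0 N hN Nm h1 h2 h3 h4)⟩
  set ξ := brandtXi (N / Nm) Nm (fun n => (freyCurve a b).LFunction n)
  have h1le : 1 ≤ ξ / (ordProj[2] ξ * ordProj[3] ξ) := (one_le_primeToSix_iff ξ).mpr hξ
  exact_mod_cast Nat.le_mul_of_pos_left
    (∏ q ∈ N.primeFactors, ((freyCurve a b).minimalDiscriminantNorm ℤ).factorization q) h1le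

/-- **Takahashi lock, pointwise: `cps δ_opt ≤ cps ξ_S · c_r`.**  From `takahashi2001_thm_2_3` (`δ i = ξ j`,
`i j = c_r = ord_r Δ_min(W)`, `0 < i`, for the optimal curve `W` of squarefree conductor `M r`, `r` prime, in every
Brandt setup `S` of type `(M, r)`) and the multiplicativity of `cps`: `cps δ ≤ cps (δ i) = cps ξ · cps j ≤ cps ξ · c_r`.
So a lower bound on the prime-to-6 part of ξ costs a lower bound on the prime-to-6 part of the OPTIMAL DEGREE.
[cite: Takahashi2001, Thm. 2.3] -/
theorem primeToSix_modularDegree_le (h : takahashi2001_thm_2_3) (W : WeierstrassCurve ℚ) [W.IsElliptic]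
    (M r : ℕ) [NeZero (M * r)] (hr : r.Prime) (hsq : Squarefree (M * r)) (hN : W.conductorNorm ℤ = M * r)
    (P : ModularParametrizationData W (M * r))
    (hmin : ∀ (W' : WeierstrassCurve ℚ) [W'.IsElliptic] (P' : ModularParametrizationData W' (M * r)),
      P'.f = P.f → P.modularDegree ≤ P'.modularDegree)
    (S : Brandt.XiSetup M r) :
    P.modularDegree / (ordProj[2] P.modularDegree * ordProj[3] P.modularDegree) ≤
      S.xi (fun n => W.LFunction n) / (ordProj[2] (S.xi (fun n => W.LFunction n)) *
        ordProj[3] (S.xi (fun n => W.LFunction n))) * (W.minimalDiscriminantNorm ℤ).factorization r := by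
  obtain ⟨i, j, hi, hij, -, hδ⟩ := h W M r hr hsq hN P hmin S
  set ξ := S.xi (fun n => W.LFunction n)
  set δ := P.modularDegree
  have hj : j ≤ (W.minimalDiscriminantNorm ℤ).factorization r := by
    rw [← hij]; exact Nat.le_mul_of_pos_left _ hi
  calc δ / (ordProj[2] δ * ordProj[3] δ)
      ≤ δ * i / (ordProj[2] (δ * i) * ordProj[3] (δ * i)) := primeToSix_le_primeToSix_mul hi.ne'
    _ = ξ * j / (ordProj[2] (ξ * j) * ordProj[3] (ξ * j)) := by rw [hδ]
    _ = ξ / (ordProj[2] ξ * ordProj[3] ξ) * (j / (ordProj[2] j * ordProj[3] j)) := primeToSix_mul ξ j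
    _ ≤ ξ / (ordProj[2] ξ * ordProj[3] ξ) * j := Nat.mul_le_mul_left _ (primeToSix_le j)
    _ ≤ _ := Nat.mul_le_mul_left _ hj

/-- **Takahashi lock: SteinbergCore ⟹ "Frey degree conjecture away from 6, up to one Tamagawa exponent".**
For coprime `a, b`, squarefree `N(E_(a,b)) = M r` with `r` an odd prime, and the `X₀(N)`-optimal curve `W` of the
Frey class (same L-function) with its minimal datum `P`:
`cps(deg P) · T(E_(a,b)) ≤ C_ε N^(2+ε) · ord_r Δ_min(W)` (instance `Nm = r` of the crux, `N / r = M`,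
`Brandt.nonempty_xiSetup_of_squarefree_mul`, `Brandt.XiSetup.brandtXi_eq_xi`, `primeToSix_modularDegree_le`).
[cite: Takahashi2001, Thm. 2.3] -/
theorem primeToSix_degree_bound_of_steinbergCore (h : takahashi2001_thm_2_3) (hSC : SteinbergCore) :
    ∀ ε : ℝ, 0 < ε → ∃ C : ℝ, ∀ a b : ℤ, IsCoprime a b → a * b * (a + b) ≠ 0 →
      ∀ M r : ℕ, r.Prime → r ≠ 2 → (freyCurve a b).conductorNorm ℤ = M * r → Squarefree (M * r) →
      ∀ (W : WeierstrassCurve ℚ) [W.IsElliptic], (∀ n, W.LFunction n = (freyCurve a b).LFunction n) →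
      W.conductorNorm ℤ = M * r → ∀ [NeZero (M * r)] (P : ModularParametrizationData W (M * r)),
      (∀ (W' : WeierstrassCurve ℚ) [W'.IsElliptic] (P' : ModularParametrizationData W' (M * r)),
          P'.f = P.f → P.modularDegree ≤ P'.modularDegree) →
      ((P.modularDegree / (ordProj[2] P.modularDegree * ordProj[3] P.modularDegree) : ℕ) : ℝ) *
          ((∏ q ∈ (M * r).primeFactors,
              ((freyCurve a b).minimalDiscriminantNorm ℤ).factorization q : ℕ) : ℝ) ≤
        C * ((M * r : ℕ) : ℝ) ^ (2 + ε) * ((W.minimalDiscriminantNorm ℤ).factorization r : ℕ) := by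
  intro ε hε
  obtain ⟨C, -, hC⟩ := steinbergCore_iff_nonneg_const.mp hSC ε hε
  refine ⟨C, fun a b hab h0 M r hr hr2 hMr hsq W _ hL hNW _ P hmin => ?_⟩
  have hodd : Odd r.primeFactors.card := by rw [hr.primeFactors]; simp
  obtain ⟨S⟩ := Brandt.nonempty_xiSetup_of_squarefree_mul (Nplus := M) (Nminus := r) hsq hodd
  have hinst := hC a b hab h0 (M * r) hMr r (hr.odd_of_ne_two hr2) (Irreducible.squarefree hr) hodd
    (Dvd.intro_left M rfl)
  rw [Nat.mul_div_cancel _ hr.pos, S.brandtXi_eq_xi] at hinst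
  have hlam : (fun n => (freyCurve a b).LFunction n) = fun n => W.LFunction n := (funext hL).symm
  rw [hlam] at hinst
  have hδ := primeToSix_modularDegree_le h W M r hr hsq hNW P hmin S
  set ξ := S.xi (fun n => W.LFunction n)
  set T := ∏ q ∈ (M * r).primeFactors, ((freyCurve a b).minimalDiscriminantNorm ℤ).factorization q
  set cr := (W.minimalDiscriminantNorm ℤ).factorization r
  set δ' := P.modularDegree / (ordProj[2] P.modularDegree * ordProj[3] P.modularDegree)
  set ξ' := ξ / (ordProj[2] ξ * ordProj[3] ξ)
  have hδR : (δ' : ℝ) ≤ (ξ' : ℝ) * (cr : ℝ) := by exact_mod_cast hδ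
  have hT : (0 : ℝ) ≤ (T : ℝ) := Nat.cast_nonneg _
  have hcr : (0 : ℝ) ≤ (cr : ℝ) := Nat.cast_nonneg _
  calc (δ' : ℝ) * (T : ℝ) ≤ (ξ' : ℝ) * (cr : ℝ) * (T : ℝ) := mul_le_mul_of_nonneg_right hδR hT
    _ = (ξ' : ℝ) * (T : ℝ) * (cr : ℝ) := by ring
    _ ≤ C * ((M * r : ℕ) : ℝ) ^ (2 + ε) * (cr : ℝ) := mul_le_mul_of_nonneg_right hinst hcr

/-- **Refutation schema (converse lock).**  Given Takahashi's theorem, `SteinbergCore` is refuted by — and, up to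
the factor `ord_r Δ_min(W) ≤ log₂|Δ_min|`, only by — a family, indexed by all `C ≥ 0` at one fixed `ε > 0`, of
Frey classes of squarefree conductor `N = M r` (`r` an odd prime) whose `X₀(N)`-optimal curve `W` has
PRIME-TO-6 degree with `cps(δ_opt) · T(E_(a,b)) > C · N^(2+ε) · ord_r Δ_min(W)`.  Since `T(E) ≤ N^(8/3+ε)`
unconditionally and `= N^(o(1))` under Szpiro, this is superquadratic growth of the prime-to-6 part of optimal
degrees in Frey classes: a failure of abc on Frey curves (deg ≤ N^(2+ε) under abc, Murty/Pasten).  No Brandt-module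
computation enters. [cite: Takahashi2001, Thm. 2.3] -/
theorem not_steinbergCore_of_large_primeToSix_optimal_degrees (h : takahashi2001_thm_2_3)
    (hfam : ∃ ε : ℝ, 0 < ε ∧ ∀ C : ℝ, 0 ≤ C → ∃ a b : ℤ, IsCoprime a b ∧ a * b * (a + b) ≠ 0 ∧
      ∃ M r : ℕ, r.Prime ∧ r ≠ 2 ∧ (freyCurve a b).conductorNorm ℤ = M * r ∧ Squarefree (M * r) ∧
      ∃ (W : WeierstrassCurve ℚ) (_ : W.IsElliptic),
        (∀ n, W.LFunction n = (freyCurve a b).LFunction n) ∧ W.conductorNorm ℤ = M * r ∧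
        ∃ (_ : NeZero (M * r)) (P : ModularParametrizationData W (M * r)),
          (∀ (W' : WeierstrassCurve ℚ) [W'.IsElliptic] (P' : ModularParametrizationData W' (M * r)),
              P'.f = P.f → P.modularDegree ≤ P'.modularDegree) ∧
          C * ((M * r : ℕ) : ℝ) ^ (2 + ε) * ((W.minimalDiscriminantNorm ℤ).factorization r : ℕ) <
            ((P.modularDegree / (ordProj[2] P.modularDegree * ordProj[3] P.modularDegree) : ℕ) : ℝ) *
              ((∏ q ∈ (M * r).primeFactors,
                  ((freyCurve a b).minimalDiscriminantNorm ℤ).factorization q : ℕ) : ℝ)) :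
    ¬ SteinbergCore := by
  rintro hSC
  obtain ⟨ε, hε, hfam⟩ := hfam
  obtain ⟨C, hC⟩ := primeToSix_degree_bound_of_steinbergCore h hSC ε hε
  obtain ⟨a, b, hab, h0, M, r, hr, hr2, hMr, hsq, W, hW, hL, hNW, hne, P, hmin, hlt⟩ :=
    hfam (max C 0) (le_max_right _ _)
  haveI := hW
  haveI := hne
  have hle := hC a b hab h0 M r hr hr2 hMr hsq W hL hNW P hmin
  have hcr : (0 : ℝ) ≤ (((W.minimalDiscriminantNorm ℤ).factorization r : ℕ) : ℝ) := Nat.cast_nonneg _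
  have hpow : (0 : ℝ) ≤ ((M * r : ℕ) : ℝ) ^ (2 + ε) := Real.rpow_nonneg (Nat.cast_nonneg _) _
  have hmono : C * ((M * r : ℕ) : ℝ) ^ (2 + ε) * ((W.minimalDiscriminantNorm ℤ).factorization r : ℕ) ≤
      max C 0 * ((M * r : ℕ) : ℝ) ^ (2 + ε) * ((W.minimalDiscriminantNorm ℤ).factorization r : ℕ) :=
    mul_le_mul_of_nonneg_right (mul_le_mul_of_nonneg_right (le_max_left _ _) hpow) hcr
  exact (not_le.mpr hlt) (hle.trans hmono)

/-! ## §C′  Refuted natural strengthening: the exponent product is not polylogarithmic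

The route's "`T(E) = N^(o(1))`" is a SZPIRO-strength input.  Unconditionally `T` is not even `O((log N)^A)`:
explicit Serre-normalised family `a = -1`, `b = 32 ∏_{i<s} p_{i+1}^j` (`s = ⌊A⌋+2`, `j → ∞`), `T ≥ (2j)^s`,
`log N ≤ 2 j log P + 10 log 2`.  (Landed copy: `Theorems/SteinbergCore/Negative/SteinbergCoreTamProdNotPolylog.lean`.) -/

/-- The odd prime power product `Q = ∏_{i<s} p_{i+1}^j`. (local abbreviation inside proofs only) -/
theorem prod_nth_prime_succ_pow_const_eq_pow (s j : ℕ) :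
    (∏ i : Fin s, Nat.nth Nat.Prime (i + 1) ^ j) = (∏ i : Fin s, Nat.nth Nat.Prime (i + 1)) ^ j :=
  Finset.prod_pow _ _ _

/-- **`T(E)` is not polylogarithmic on Frey curves.**  For every `A, C` there is a coprime pair (`a = -1`,
`b = 32 ∏_{i<s} p_{i+1}^j`) with `T(E_(a,b)) = ∏_{q ∣ N} v_q(Δ_min) > C (log N)^A`. [folklore] -/
theorem not_tamProd_freyCurve_le_polylog :
    ¬ ∃ A C : ℝ, ∀ a b : ℤ, IsCoprime a b → a * b * (a + b) ≠ 0 →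
      ((∏ q ∈ ((freyCurve a b).conductorNorm ℤ).primeFactors,
          ((freyCurve a b).minimalDiscriminantNorm ℤ).factorization q : ℕ) : ℝ) ≤
        C * Real.log ((freyCurve a b).conductorNorm ℤ) ^ A := by
  rintro ⟨A, C, h⟩
  -- WLOG `A ≥ 0`, `C ≥ 0`
  set A' : ℝ := max A 0 with hA'
  set C' : ℝ := max C 0 with hC'
  have hA'0 : 0 ≤ A' := le_max_right _ _
  have hC'0 : 0 ≤ C' := le_max_right _ _
  -- number of primes in the family
  set s : ℕ := ⌊A'⌋₊ + 2 with hs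
  have hs1 : 1 ≤ s := by omega
  have hsA : A' + 1 ≤ (s : ℝ) := by
    have := Nat.lt_floor_add_one A'
    rw [hs]; push_cast; linarith
  set P : ℕ := ∏ i : Fin s, Nat.nth Nat.Prime (i + 1) with hP
  have hP3 : 3 ≤ P := Masser.three_le_prod_nth_prime_succ hs1
  have hP0 : 0 < P := by omega
  set L : ℝ := Real.log P with hL
  have hL0 : 0 < L := Real.log_pos (by exact_mod_cast (show 1 < P by omega))
  set c₀ : ℝ := Real.log 1024 with hc₀
  have hc₀0 : 0 ≤ c₀ := Real.log_nonneg (by norm_num)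
  -- the key estimate at exponent `j ≥ 1`: `(2j)^s ≤ T ≤ C' (c₀ + 2 j L)^A'`
  have key : ∀ j : ℕ, 1 ≤ j → ((2 * j) ^ s : ℝ) ≤ C' * (c₀ + 2 * j * L) ^ A' := by
    intro j hj
    set Q : ℕ := ∏ i : Fin s, Nat.nth Nat.Prime (i + 1) ^ j with hQ
    have hQP : Q = P ^ j := prod_nth_prime_succ_pow_const_eq_pow s j
    have hQ0 : 0 < Q := prod_nth_prime_succ_pow_pos _
    have hQodd : ¬ 2 ∣ Q := by
      rw [hQP]; exact fun h2 => not_two_dvd_prod_nth_prime_succ s (Nat.prime_two.dvd_of_dvd_pow h2)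
    -- the pair
    set a : ℤ := -1 with ha
    set b : ℤ := 32 * Q with hb
    have hab : IsCoprime a b := isCoprime_one_left.neg_left
    have hmZ : a * b * (a + b) = -((32 * Q * (32 * Q - 1) : ℕ) : ℤ) := by
      have h1 : 1 ≤ 32 * Q := by omega
      rw [ha, hb]; push_cast [Nat.cast_sub h1]; ring
    set m : ℕ := 32 * Q * (32 * Q - 1) with hm
    have hm0 : m ≠ 0 := by
      have : 1 ≤ 32 * Q - 1 := by omega
      positivity
    have h0 : a * b * (a + b) ≠ 0 := by
      rw [hmZ, neg_ne_zero]; exact_mod_cast hm0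
    have hmod : a ≡ -1 [ZMOD 4] := Int.ModEq.refl _
    have h32 : (32 : ℤ) ∣ b := Dvd.intro _ rfl
    have hnat : (a * b * (a + b)).natAbs = m := by rw [hmZ, Int.natAbs_neg, Int.natAbs_natCast]
    -- conductor and exponents in Serre's normalisation
    have hN : (freyCurve a b).conductorNorm ℤ = radical m := by
      rw [conductorNorm_freyCurve_serre hab h0 hmod h32, hnat]
    have hfac : ∀ p : ℕ, ((freyCurve a b).minimalDiscriminantNorm ℤ).factorization p =
        2 * m.factorization p - if p = 2 then 8 else 0 := by
      intro p; rw [factorization_minimalDiscriminantNorm_freyCurve_serre hab h0 hmod h32 p, hnat]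
    have hpf : ((freyCurve a b).conductorNorm ℤ).primeFactors = m.primeFactors := by
      rw [hN, Nat.primeFactors_radical]
    -- `v_2(m) = 5`
    have hodd' : ¬ 2 ∣ 32 * Q - 1 := by omega
    have hm2 : m.factorization 2 = 5 := by
      have h32Q : (32 * Q).factorization 2 = 5 := by
        rw [Nat.factorization_mul (by norm_num) hQ0.ne', Finsupp.add_apply,
          Nat.factorization_eq_zero_of_not_dvd hQodd, add_zero,
          show (32 : ℕ) = 2 ^ 5 by norm_num, Nat.prime_two.factorization_pow]
        simp
      rw [hm, Nat.factorization_mul (by omega) (by omega), Finsupp.add_apply, h32Q,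
        Nat.factorization_eq_zero_of_not_dvd hodd', add_zero]
    -- every factor of `T` is `≥ 1`, and the factor at `p_{i+1}` is `≥ 2 j`
    have hge1 : ∀ q ∈ m.primeFactors, 1 ≤ 2 * m.factorization q - if q = 2 then 8 else 0 := by
      intro q hq
      obtain ⟨hqp, hqd, -⟩ := Nat.mem_primeFactors.mp hq
      by_cases hq2 : q = 2
      · subst hq2; simp [hm2]
      · rw [if_neg hq2]; have := hqp.factorization_pos_of_dvd hm0 hqd; omega
    have hQm : Q ∣ m := ⟨32 * (32 * Q - 1), by rw [hm]; ring⟩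
    have hvQ : ∀ i : Fin s, Q.factorization (Nat.nth Nat.Prime (i + 1)) = j := fun i =>
      factorization_prod_nth_prime_succ_pow (fun _ => j) i
    have hgej : ∀ i : Fin s, 2 * j ≤ 2 * m.factorization (Nat.nth Nat.Prime (i + 1)) -
        if Nat.nth Nat.Prime (i + 1) = 2 then 8 else 0 := by
      intro i
      have hne2 : Nat.nth Nat.Prime (i + 1) ≠ 2 := (two_lt_nth_prime_succ i).ne'
      rw [if_neg hne2, Nat.sub_zero]
      have hle : Q.factorization (Nat.nth Nat.Prime (i + 1)) ≤ m.factorization (Nat.nth Nat.Prime (i + 1)) :=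
        (Nat.factorization_le_iff_dvd hQ0.ne' hm0).mpr hQm _
      rw [hvQ i] at hle
      omega
    -- the set of family primes inside `m.primeFactors`
    set S : Finset ℕ := Finset.univ.image fun i : Fin s => Nat.nth Nat.Prime (i + 1) with hSdef
    have hinj : Function.Injective fun i : Fin s => Nat.nth Nat.Prime (i + 1) := by
      intro i i' hii'
      exact Fin.ext (by simpa using (Nat.nth_injective Nat.infinite_setOf_prime) hii')
    have hSsub : S ⊆ m.primeFactors := by
      intro q hq
      obtain ⟨i, -, rfl⟩ := Finset.mem_image.mp hq
      refine Nat.mem_primeFactors.mpr ⟨Nat.prime_nth_prime _, ?_, hm0⟩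
      have : Nat.nth Nat.Prime (i + 1) ∣ Q :=
        (dvd_pow_self _ (by omega : j ≠ 0)).trans
          (Finset.dvd_prod_of_mem (fun i : Fin s => Nat.nth Nat.Prime (i + 1) ^ j) (Finset.mem_univ i))
      exact this.trans hQm
    have hT : (2 * j) ^ s ≤ ∏ q ∈ m.primeFactors, (2 * m.factorization q - if q = 2 then 8 else 0) := by
      calc (2 * j) ^ s = ∏ _i : Fin s, (2 * j) := by simp [Finset.prod_const]
        _ ≤ ∏ i : Fin s, (2 * m.factorization (Nat.nth Nat.Prime (i + 1)) -
              if Nat.nth Nat.Prime (i + 1) = 2 then 8 else 0) :=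
            Finset.prod_le_prod' fun i _ => hgej i
        _ = ∏ q ∈ S, (2 * m.factorization q - if q = 2 then 8 else 0) := by
            rw [hSdef, Finset.prod_image fun i _ i' _ h => hinj h]
        _ ≤ ∏ q ∈ m.primeFactors, (2 * m.factorization q - if q = 2 then 8 else 0) :=
            Finset.prod_le_prod_of_subset_of_one_le' hSsub fun q hq _ => hge1 q hq
    -- `T(E_(a,b))` rewritten
    have hTE : (∏ q ∈ ((freyCurve a b).conductorNorm ℤ).primeFactors,
        ((freyCurve a b).minimalDiscriminantNorm ℤ).factorization q) =
        ∏ q ∈ m.primeFactors, (2 * m.factorization q - if q = 2 then 8 else 0) := by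
      rw [hpf]; exact Finset.prod_congr rfl fun q _ => hfac q
    -- the bound from the hypothesis, with `A', C'`
    have hinst := h a b hab h0
    rw [hTE] at hinst
    -- size of `N`: `3 ≤ N ≤ 1024 P^(2j)`
    haveI := isElliptic_freyCurve h0
    have hNpos : 0 < (freyCurve a b).conductorNorm ℤ := WeierstrassCurve.conductorNorm_pos_holds _
    have hNle : ((freyCurve a b).conductorNorm ℤ : ℝ) ≤ 1024 * (P : ℝ) ^ (2 * j) := by
      have h1 : (freyCurve a b).conductorNorm ℤ ≤ m := by
        rw [hN]; exact Nat.le_of_dvd (Nat.pos_of_ne_zero hm0) radical_dvd_self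
      have h2 : m ≤ 1024 * P ^ (2 * j) := by
        have : 32 * Q * (32 * Q - 1) ≤ 32 * Q * (32 * Q) := Nat.mul_le_mul_left _ (Nat.sub_le _ _)
        calc m = 32 * Q * (32 * Q - 1) := hm
          _ ≤ 32 * Q * (32 * Q) := this
          _ = 1024 * P ^ (2 * j) := by rw [hQP]; ring
      exact_mod_cast h1.trans h2
    have hN3 : 3 ≤ (freyCurve a b).conductorNorm ℤ := by
      have h3P : 3 ∣ P := by
        have : Nat.nth Nat.Prime ((⟨0, hs1⟩ : Fin s) + 1) ∣ P :=
          Finset.dvd_prod_of_mem (fun i : Fin s => Nat.nth Nat.Prime (i + 1)) (Finset.mem_univ _)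
        simpa [Nat.nth_prime_one_eq_three] using this
      have h3Q : 3 ∣ Q := hQP ▸ h3P.trans (dvd_pow_self P (by omega))
      have h3m : 3 ∣ m := h3Q.trans hQm
      have h3N : 3 ∣ (freyCurve a b).conductorNorm ℤ := by
        rw [hN]; exact (dvd_radical_iff_of_irreducible Nat.prime_three hm0).mpr h3m
      exact Nat.le_of_dvd hNpos h3N
    -- logarithms
    have hNposR : (0 : ℝ) < ((freyCurve a b).conductorNorm ℤ : ℝ) := by exact_mod_cast hNpos
    have hlog1 : 1 ≤ Real.log ((freyCurve a b).conductorNorm ℤ : ℝ) := by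
      have h3 : Real.exp 1 < 3 := lt_trans Real.exp_one_lt_d9 (by norm_num)
      have : (3 : ℝ) ≤ ((freyCurve a b).conductorNorm ℤ : ℝ) := by exact_mod_cast hN3
      exact ((Real.lt_log_iff_exp_lt hNposR).mpr (h3.trans_le this)).le
    have hlog0 : 0 ≤ Real.log ((freyCurve a b).conductorNorm ℤ : ℝ) := zero_le_one.trans hlog1
    have hlogle : Real.log ((freyCurve a b).conductorNorm ℤ : ℝ) ≤ c₀ + 2 * j * L := by
      have hP0R : (0 : ℝ) < (P : ℝ) := by exact_mod_cast hP0
      calc Real.log ((freyCurve a b).conductorNorm ℤ : ℝ) ≤ Real.log (1024 * (P : ℝ) ^ (2 * j)) :=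
            Real.log_le_log hNposR hNle
        _ = c₀ + 2 * j * L := by
            rw [Real.log_mul (by norm_num) (pow_ne_zero _ hP0R.ne'), Real.log_pow]; push_cast; ring
    -- assemble
    have hTR : ((2 * j) ^ s : ℝ) ≤ ((∏ q ∈ m.primeFactors, (2 * m.factorization q - if q = 2 then 8 else 0) : ℕ) : ℝ) := by
      exact_mod_cast hT
    refine hTR.trans (hinst.trans ?_)
    have hrA : Real.log ((freyCurve a b).conductorNorm ℤ : ℝ) ^ A ≤
        Real.log ((freyCurve a b).conductorNorm ℤ : ℝ) ^ A' :=
      Real.rpow_le_rpow_of_exponent_le hlog1 (le_max_left _ _)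
    have hrA' : Real.log ((freyCurve a b).conductorNorm ℤ : ℝ) ^ A' ≤ (c₀ + 2 * j * L) ^ A' :=
      Real.rpow_le_rpow hlog0 hlogle hA'0
    have hr0 : 0 ≤ Real.log ((freyCurve a b).conductorNorm ℤ : ℝ) ^ A := Real.rpow_nonneg hlog0 _
    calc C * Real.log ((freyCurve a b).conductorNorm ℤ : ℝ) ^ A
        ≤ C' * Real.log ((freyCurve a b).conductorNorm ℤ : ℝ) ^ A := mul_le_mul_of_nonneg_right (le_max_left _ _) hr0
      _ ≤ C' * (c₀ + 2 * j * L) ^ A' := mul_le_mul_of_nonneg_left (hrA.trans hrA') hC'0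
  -- endgame: `j^(A'+1) ≤ (2j)^s ≤ K j^A'` is impossible for `j > K`
  set K : ℝ := C' * (c₀ + 2 * L) ^ A' with hK
  have hK0 : 0 ≤ K := mul_nonneg hC'0 (Real.rpow_nonneg (by positivity) _)
  set j : ℕ := ⌊K⌋₊ + 1 with hj
  have hj1 : 1 ≤ j := by omega
  have hjK : K < (j : ℝ) := by rw [hj]; push_cast; exact Nat.lt_floor_add_one K
  have hjpos : (0 : ℝ) < (j : ℝ) := by exact_mod_cast (show 0 < j by omega)
  have hj1R : (1 : ℝ) ≤ (j : ℝ) := by exact_mod_cast hj1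
  have hkey := key j hj1
  -- RHS ≤ K · j^A'
  have hRHS : C' * (c₀ + 2 * j * L) ^ A' ≤ K * (j : ℝ) ^ A' := by
    have hle : c₀ + 2 * j * L ≤ (j : ℝ) * (c₀ + 2 * L) := by nlinarith
    have hnn : (0 : ℝ) ≤ c₀ + 2 * j * L := by positivity
    calc C' * (c₀ + 2 * j * L) ^ A' ≤ C' * ((j : ℝ) * (c₀ + 2 * L)) ^ A' :=
          mul_le_mul_of_nonneg_left (Real.rpow_le_rpow hnn hle hA'0) hC'0
      _ = K * (j : ℝ) ^ A' := by
          rw [Real.mul_rpow hjpos.le (by positivity), hK]; ring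
  -- LHS ≥ j^A' · j
  have hLHS : (j : ℝ) ^ A' * j ≤ ((2 * j) ^ s : ℝ) := by
    have h1 : (j : ℝ) ^ A' * j = (j : ℝ) ^ (A' + 1) := (Real.rpow_add_one hjpos.ne' A').symm
    have h2 : (j : ℝ) ^ (A' + 1) ≤ (j : ℝ) ^ (s : ℝ) := Real.rpow_le_rpow_of_exponent_le hj1R hsA
    have h3 : (j : ℝ) ^ (s : ℝ) = (j : ℝ) ^ s := Real.rpow_natCast _ _
    have h4 : ((j : ℝ)) ^ s ≤ ((2 * j) ^ s : ℝ) := by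
      gcongr; linarith
    linarith [h1, h2, h3, h4]
  have hfin : (j : ℝ) ^ A' * j ≤ (j : ℝ) ^ A' * K := by
    calc (j : ℝ) ^ A' * j ≤ K * (j : ℝ) ^ A' := hLHS.trans (hkey.trans hRHS)
      _ = (j : ℝ) ^ A' * K := mul_comm _ _
  have hjA : (0 : ℝ) < (j : ℝ) ^ A' := Real.rpow_pos_of_pos hjpos _
  exact (not_le.mpr hjK) (le_of_mul_le_mul_left hfin hjA)


/-! ## §D  Load-bearing hypotheses -/

/-- The crux with the guard `0 < ε` dropped (every real `ε`). -/
def SteinbergCoreWithoutEpsPos : Prop :=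
  ∀ ε : ℝ, ∃ C : ℝ, ∀ a b : ℤ, IsCoprime a b → a * b * (a + b) ≠ 0 → ∀ (N : ℕ) [NeZero N],
    (freyCurve a b).conductorNorm ℤ = N → ∀ Nm : ℕ, Odd Nm → Squarefree Nm → Odd Nm.primeFactors.card →
    Nm ∣ N →
    ((brandtXi (N / Nm) Nm (fun n => (freyCurve a b).LFunction n) /
        (ordProj[2] (brandtXi (N / Nm) Nm (fun n => (freyCurve a b).LFunction n)) *
          ordProj[3] (brandtXi (N / Nm) Nm (fun n => (freyCurve a b).LFunction n))) : ℕ) : ℝ) *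
      ((∏ q ∈ N.primeFactors, ((freyCurve a b).minimalDiscriminantNorm ℤ).factorization q : ℕ) : ℝ) ≤
      C * (N : ℝ) ^ (2 + ε)

/-- **H (formal debt, TRUE by Wiles/BCDT + the strong Weil curve of an isogeny class): optimal data exist on Frey
classes of unbounded squarefree conductor.**  For every `N₀` some coprime `a, b` (`ab(a+b) ≠ 0`) have squarefree
Frey conductor `N = M r > N₀` with `r` an odd prime, and the Frey class carries an `X₀(N)`-optimal curve `W` (same
L-function, conductor `N`) with a datum `P` of minimal degree among all data with the same newform.  Arithmetic
half in the tree: `FreyDegreeBound.Negative.exists_frey_pair_excess` (Serre-normalised pairs, `N = rad` squarefree,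
`N > N₀`, an odd prime `q ∣ N`); modular half = route item `FreyModularity` transported to the optimal curve. -/
def FreyOptimalDataUnbounded : Prop :=
  ∀ N₀ : ℕ, ∃ a b : ℤ, IsCoprime a b ∧ a * b * (a + b) ≠ 0 ∧ ∃ M r : ℕ, r.Prime ∧ r ≠ 2 ∧ N₀ < M * r ∧
    (freyCurve a b).conductorNorm ℤ = M * r ∧ Squarefree (M * r) ∧
    ∃ (W : WeierstrassCurve ℚ) (_ : W.IsElliptic), (∀ n, W.LFunction n = (freyCurve a b).LFunction n) ∧
      W.conductorNorm ℤ = M * r ∧ ∃ (_ : NeZero (M * r)) (P : ModularParametrizationData W (M * r)),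
        ∀ (W' : WeierstrassCurve ℚ) [W'.IsElliptic] (P' : ModularParametrizationData W' (M * r)),
          P'.f = P.f → P.modularDegree ≤ P'.modularDegree

/-- **`0 < ε` is load-bearing**: with the guard dropped, `ε = -3` asks for `cps ξ · T ≤ C / N`, but on optimal Frey
data `ξ_S ≠ 0` (`takahashi2001_thm_2_3.xi_ne_zero`: `δ i = ξ j` with `δ i ≥ 1`), so `cps ξ ≥ 1`, and `T ≥ 1`
(`one_le_tamProd`): the left side is `≥ 1 > C / N` once `N > C`.  Modulo Takahashi's theorem (named fact) and the
existence of optimal Frey data of unbounded conductor (`FreyOptimalDataUnbounded`, BCDT). [cite: Takahashi2001, Thm. 2.3] -/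
theorem steinbergCore_false_without_eps_pos (h : takahashi2001_thm_2_3) (hopt : FreyOptimalDataUnbounded) :
    ¬ SteinbergCoreWithoutEpsPos := by
  intro hW
  obtain ⟨C, hC⟩ := hW (-3)
  obtain ⟨a, b, hab, h0, M, r, hr, hr2, hN0, hMr, hsq, W, hWell, hL, hNW, hne, P, hmin⟩ :=
    hopt ⌈max C 0⌉₊
  haveI := hWell
  haveI := hne
  have hodd : Odd r.primeFactors.card := by rw [hr.primeFactors]; simp
  obtain ⟨S⟩ := Brandt.nonempty_xiSetup_of_squarefree_mul (Nplus := M) (Nminus := r) hsq hodd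
  have hinst := hC a b hab h0 (M * r) hMr r (hr.odd_of_ne_two hr2) (Irreducible.squarefree hr) hodd
    (Dvd.intro_left M rfl)
  rw [Nat.mul_div_cancel _ hr.pos, S.brandtXi_eq_xi] at hinst
  have hlam : (fun n => (freyCurve a b).LFunction n) = fun n => W.LFunction n := (funext hL).symm
  rw [hlam] at hinst
  have hξ : S.xi (fun n => W.LFunction n) ≠ 0 := h.xi_ne_zero W M r hr hsq hNW P hmin S
  set ξ := S.xi (fun n => W.LFunction n)
  have h1 : 1 ≤ ξ / (ordProj[2] ξ * ordProj[3] ξ) := (one_le_primeToSix_iff ξ).mpr hξ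
  haveI := isElliptic_freyCurve h0
  have hT : 1 ≤ ∏ q ∈ (M * r).primeFactors, ((freyCurve a b).minimalDiscriminantNorm ℤ).factorization q := by
    rw [← hMr]; exact one_le_tamProd (freyCurve a b)
  have hLHS : (1 : ℝ) ≤ ((ξ / (ordProj[2] ξ * ordProj[3] ξ) : ℕ) : ℝ) *
      ((∏ q ∈ (M * r).primeFactors, ((freyCurve a b).minimalDiscriminantNorm ℤ).factorization q : ℕ) : ℝ) := by
    have h1' : (1 : ℝ) ≤ ((ξ / (ordProj[2] ξ * ordProj[3] ξ) : ℕ) : ℝ) := by exact_mod_cast h1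
    have hT' : (1 : ℝ) ≤ ((∏ q ∈ (M * r).primeFactors,
        ((freyCurve a b).minimalDiscriminantNorm ℤ).factorization q : ℕ) : ℝ) := by exact_mod_cast hT
    nlinarith
  have hNpos : (0 : ℝ) < ((M * r : ℕ) : ℝ) := by exact_mod_cast Nat.pos_of_ne_zero (NeZero.ne (M * r))
  have hrpow : ((M * r : ℕ) : ℝ) ^ ((2 : ℝ) + -3) = ((M * r : ℕ) : ℝ)⁻¹ := by
    rw [show (2 : ℝ) + -3 = -1 by norm_num, Real.rpow_neg_one]
  rw [hrpow] at hinst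
  have hN0' : max C 0 < ((M * r : ℕ) : ℝ) := by exact_mod_cast Nat.lt_of_ceil_lt hN0
  have hlt : C * ((M * r : ℕ) : ℝ)⁻¹ < 1 :=
    calc C * ((M * r : ℕ) : ℝ)⁻¹ ≤ max C 0 * ((M * r : ℕ) : ℝ)⁻¹ :=
          mul_le_mul_of_nonneg_right (le_max_left _ _) (inv_nonneg.mpr hNpos.le)
      _ < ((M * r : ℕ) : ℝ) * ((M * r : ℕ) : ℝ)⁻¹ := mul_lt_mul_of_pos_right hN0' (inv_pos.mpr hNpos)
      _ = 1 := mul_inv_cancel₀ hNpos.ne'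
  exact (not_le.mpr hlt) (hLHS.trans hinst)

/-! ## §D′  The other hypotheses (analysis; no refutation handle)

* `Squarefree Nm`, `Odd ω(Nm)`: decorative (`steinbergCore_iff_dropParityAndSquarefree`).
* `Nm ∣ N`: mathematically decorative too — for `Nm ∤ N` the level `(N/Nm)·Nm < N` carries no eigenvector with
  the `a_p(E)` system (strong multiplicity one), the eigen-lattice is `⊥`, `ξ = 0`, instance trivially true; not
  provable in the tree (no JL/SMO for Brandt modules), not a handle either way.
* `Odd Nm`: dropping it ADDS genuine instances (`2 ∈ N⁻`, forms Steinberg at `2`, setups exist iff `2 ∥ N`,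
  `XiBound.Negative.nonempty_xiSetup_freyCurve_even_iff`) of the same abc-strength — possibly unnecessary, not refutable.
* `IsCoprime a b`: `(da', db')` is `E_(a',b')` for square `d` and its quadratic twist otherwise; twists keep
  `deg ≤ N^(2+ε)` under abc, and at the primes of `d` no admissible setup exists (`q² ∣ N`); stronger statement, still
  abc-implied — not a handle.
* `a b (a+b) ≠ 0`: singular cubic, `conductorNorm` junk; guarded by the planner on purpose; not analysed.
* `0 < ε`: LOAD-BEARING (`steinbergCore_false_without_eps_pos`, §D).
* exponent `2`: heuristically sharp (Masser families: `deg ≥ N^(2-o(1))`, and on them `T(E) ≈ exp(Θ(√log N))` —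
  BarrierNotesIdeator2 §3), but NOT certifiable here: a lower bound on `cps ξ` needs a lower bound on the PRIME-TO-6
  part of the optimal degree (`primeToSix_modularDegree_le` runs the wrong way for that; nobody controls `v₂(deg)`
  from above — that is crux `EisensteinQuarantine`).  Census (CensusIdeator1, kit j015837): `cps(deg) ≤ N^0.93` while
  `deg ≤ N^1.85` on 72 high-quality Frey curves; `log LHS/log N ≤ 1.88` (N = 1110), `≤ 1.71` for `N ≥ 2·10⁴`.

## §E  Line `Sketch` (card `steinberg-linvariant-slice`; skeleton `Cruxes/SteinbergCore/Lines/Sketch.lean`)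

E1. JOINT SUFFICIENCY holds by construction: `SteinbergCore_of := core_of_ledgerSplit onLevel capped …
    stub_sliceExcess stub_ledgerCore` is kernel-checked and general in `(on, cap)`; nothing is smuggled.  The split is
    lossless only because `stub_ledgerCore` is the crux with `on` replaced by `cap ≤ on`
    (`ledgerCore_of_steinbergCore`): the residual stub is crux-sized (abc-strength), as PICKED.md says.

E2. `stub_sliceExcess` AS STATED — advisory `stub-misstated` (posted on the item): at a single on-level prime
    `Nm = ℓ` (`ℓ ≥ 5`, `ℓ ∣ N`; these are among the stub's instances and are the ones the tree can compare, E3)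
    Takahashi 2001 Thm 2.3 (`ξ(N/ℓ;ℓ)·j = δ_opt·i`, `i j = c_ℓ`; tree fact `takahashi2001_thm_2_3`, squarefree `N`)
    gives `v_ℓ ξ(N/ℓ;ℓ) = v_ℓ δ_opt` whenever `ℓ ∤ c_ℓ`, and level-lowering at the NON-quarantined primes gives
    `v_ℓ δ_opt ≥ Σ_{q ∣ N/ℓ} v_ℓ(c_q)` (Ribet–Takahashi `η(N) = ξ(N⁺,N⁻) ∏_{q∣N⁻} c_q` away from Eisenstein primes;
    PW Thm 6.8).  The ledger `v_ℓ(c_ℓ) + W_ℓ + 1` is LOCAL AT ℓ and ignores this.  Worked instance: the triple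
    `512 + 243 = 755 = 5·151` has `v₂(abc) = 9`, `v₃(abc) = 5`, `v₅(abc) = 1`, so (Serre-normalised arrangement,
    semistable at 2) `c₂ = 2·9 − 8 = 10`, `c₃ = 10`, `c₅ = 2`: two level-lowering primes with `5 ∣ c_q`, whence
    `v₅ ξ(N/5; 5) = v₅ δ_opt ≥ 2`, while the ledger at `ℓ = 5` is `v₅(c₅) + W₅ + 1 = 0 + 0 + 1 = 1`
    (`W₅ = v₅(151⁴ − (16·512)⁴) − 1 = 0`: `151 ≡ 1`, `8192 ≡ 17 (mod 25)`, `17⁴ ≡ 21`, difference `≡ 5 (mod 25)`).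
    PARI CONFIRMATION (kit j017466): `(a,b) = (243,512)`: `N = 4530 = 2·3·5·151` (semistable), `c_q = (10,10,2,2)`,
    `deg = 16000 = 2⁷·5³`, so `v₅ ξ(906;5) = v₅ deg = 3` against the filed ledger exponent `1` — excess factor `25`
    at `N = 4530` (`log 25 / log N = 0.38`); and `3 = LL + ledger = (1+1) + 1`: the REPAIRED ledger below is exactly
    tight here.  The `−1`-twisted arrangement `(512,243)`: `N = 36240 = 2⁴·2265`, `deg = 384000 = 2¹⁰·3·5³`, same `v₅`.
    Such pointwise excess is absorbed by the stub's `C N^ε` ONLY IF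
    `∏_{q ∣ N, q ∤ Nm} ℓ^{v_ℓ(c_q)} ≤ C_ε N^ε` — a `T`-type input (true under `T = N^(o(1))`, i.e. under Szpiro;
    unconditionally only Pasten's `N^(8/3+ε)`, and NOT polylog, §C′).  So as stated the "abc-free" stub silently
    contains a Tamagawa-product bound on top of the L-invariant rigidity.
    REPAIR (free — `core_of_ledgerSplit` takes any cap, and the residual stays crux-implied as long as `cap ≤ on`):
    `cappedExp' ℓ v := min v (ledgerExp + Σ_{q ∣ N, q ∤ Nm} v_ℓ(v_q Δ_min))` — the ℓ-part of EisensteinQuarantine's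
    allowance `𝓛` added to the ledger exponent.

E3. REGIME WITHOUT A COMPARISON THEOREM: for composite `Nm ∋ ℓ` the identity
    `v_ℓ ξ(N⁺,N⁻) = v_ℓ deg − Σ_{q∣N⁻} v_ℓ(c_q)` AT THE RESIDUE CHARACTERISTIC `ℓ ∣ N⁻` is outside the tree's
    `PollackWeston2011.thm_6_8_ellipticCurve` (hypothesis `p ∤ N⁺N⁻`) and outside Böckle–Khare–Manning
    (arXiv:2108.09729 Thm 1.1: `p ∤ NQ`, read p. 3); only `Nm = ℓ` is backed (Takahashi 2.3, an integer identity).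
    CensusIdeator1's `vxi_ℓ` at composite maximal `N⁻` is therefore an extrapolation of (F1); the statistic in E4 is
    taken at `Nm = ℓ`.

E4. CENSUS (kit j017472; script `census/census.gp` of the refuter folder, summary `stubs/census_j017472.md` attached as
    evidence): ALL coprime `a > b ≥ 1` with `c ≤ 2500` and Frey conductor `N ≤ 8·10⁴` — 3833 curves (median
    `N = 30504`), 10029 on-level instances `(E, ℓ)`, `ℓ ≥ 5`, `ℓ ∣ N`; PARI 2.15.4 `ellmoddegree` (`= deg/c_Manin²`;
    `ℓ ≥ 5` valuations are isogeny- and Manin-safe on Frey classes).  Rows `ONLEV N a b ℓ vD vcl W degen LL cap EXC`.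
    (a) KILL CRITERION (b) of the route: `log(cps(deg)·T)/log N ≤ 1.667` overall (N = 570), `≤ 1.437` for `N ≥ 10⁴`,
        `≤ 1.396` for `N ≥ 2·10⁴`; mean `0.71`.  No strike, none expected below abc-quality `> 1`.
    (b) ADDITIVITY `v_ℓ(deg) ≥ LL := Σ_{q ∣ N, q ≠ ℓ} v_ℓ(c_q)`: 0 failures in 10029 (level-lowering at the
        non-quarantined primes is always inside the degree, as E2 uses).
    (c) CLEAN ON-LEVEL DEPTH `X = v_ℓ(deg)` at instances with `vcl = W = LL = 0`, non-degenerate (nothing in the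
        ledger explains any depth; the filed AND the repaired ledger both predict `X ≤ 1`):
          ℓ = 5:  n = 1602, X ≥ 1: 333 (0.208 ≈ 1/5), X ≥ 2: 31, X = 3: 1  — ratios 1/5, then 0.093, then 0.032;
          ℓ = 7:  n = 1341, X ≥ 1: 165 (0.123 ≈ 1/7·0.86), X ≥ 2: 13, X = 3: 1 — ratios 1/8, 0.079, 0.077;
          ℓ = 11: n = 849, 60 / 0 ;  ℓ = 13: 726, 43 / 1 ;  ℓ = 17: 533, 14 / 1 ;  ℓ = 19: 437, 14 / 0;
          ℓ ≥ 17 pooled: n = 4428, X ≥ 1: 56 (1.3 %), X = 2: 1.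
        Same picture on the semistable sub-population (`2 ∥ N`, where Takahashi 2.3 applies verbatim):
        ℓ = 5: 502 / 106 / 15;  ℓ = 7: 433 / 54 / 5.
    (d) REPAIRED-LEDGER EXCESS `EXC' := vD − LL − (vcl + W + 1) ≥ 1`: 50 instances (N from 7995 to 77777, spread
        uniformly), two of size 2: `N = 24720, (a,b) = (512,3), ℓ = 5, v₅ deg = 3` and `N = 77777 = 7·11111,
        (a,b) = (271,16), ℓ = 7, v₇ deg = 3` (both `LL = vcl = W = 0`): factors `25`, `49` that no term of the card's
        ledger accounts for; largest `EXC'·log ℓ / log N = 0.35`.  Filed-ledger excess `EXC ≥ 1`: 81 instances, max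
        slack exponent `0.41` (`N = 14574`, `(1701, 347)`, ℓ = 7: `vD = 3 = LL 1 + 2`).
    (e) THE WIEFERICH TERM IS REAL BUT NOT THE WHOLE STORY: `P(vD − LL ≥ 1)` is 7.6 % at `W = 0` (689/9093), 14.3 % at
        `W = 1` (108/757), 15.7 % at `W = 2` (21/134), 25 % at `W = 3` (5/20): a Wieferich coincidence of the Tate
        unit doubles–triples the on-level congruence rate (qualitative support for the L-invariant mechanism), yet
        depth `≥ 1` occurs at the plain rate `≈ 1/ℓ` without it, and depth `≥ 2` at `≈ 1/ℓ · 1/(2ℓ)`.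
    VERDICT (numerical, not a proof): the on-level depth beyond the ledger is NOT rigid at `N ≤ 8·10⁴` — its tail is
    geometric with ratio `≈ 1/(2ℓ)` per extra level and shows no truncation in `N`.

E5. WHAT THIS MEANS FOR THE STUB.  `stub_sliceExcess` is an `∃ C ∀` statement: no census refutes it (`C = 49`, `ε = 0`
    covers every row above).  But extrapolating the fitted tail `P(EXC' ≥ e) ≈ ℓ^(-1) (2ℓ)^(-(e-1))`: among the
    `≫ X^κ` Frey curves of conductor `≤ X` with `ℓ = 5 ∣ N` (κ ≥ 2/3), the violation `5^(EXC') > C N^ε` has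
    probability `≈ N^(-ε log 10/log 5) = N^(-1.43 ε)`, so violations are infinite in number for every `ε < κ/1.43`
    (≈ 0.47 … 0.7): under the random model the stub — filed or repaired — is FALSE for small ε, and it is true only
    if the tail TRUNCATES at large `N` (the card's unprinted "non-conspiracy of partners' L-invariants").  The census
    sees depth-3 events at `N = 24720` and `77777` and a flat event rate in `N`; nothing suggests truncation.  Posted
    to the item as `stub-misstated` (E2, with the repair) plus this numerical caveat; the lead should treat
    `stub_sliceExcess` as CONJECTURAL AND NUMERICALLY DISFAVOURED in its pointwise-rigidity reading, and at best
    true in an averaged/probabilistic sense that the current skeleton does not state.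

## Targets

payload.targets = [] and payload.stuck_stubs = [] at this cycle (lead cycle 0).  Stub statements attacked anyway:
`stub_sliceExcess` (E2–E5: misstated as filed; repaired form = the open rigidity conjecture; numerically undecided
pending j017203), `stub_ledgerCore` (crux-sized by the lead's own converse; no separate attack possible).
-/

end Summit.ABC.ABC.Cruxes.SteinbergCore.Disproof
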